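import Summits.HodgeConjecture.HodgeConjecture.Theorems.BoundaryReadoutBoundarySupplyZeroFloor
import Summits.HodgeConjecture.HodgeConjecture.Theorems.BoundaryReadoutBoundarySupplyDegreeZeroCharts
import Literature.AlgebraicGeometry.HodgeTheory.GysinFormalismHodgeOfGysin
import HarnessLib

/-!
# Boundary readout — degree zero: the first nonzero absolute Hodge classes, and the exact content of `BoundarySupply`

Route `BoundaryReadout` of the Hodge conjecture, crux #2 `BoundarySupply` (stmt-HodgeConjecture-15912).
The zero floor (`BoundaryReadoutBoundarySupplyZeroFloor`) left the crux equivalent to its restriction to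
`p = 0 ∨ (1 ≤ p ≤ dim X ∧ c ≠ 0)` (`boundarySupply_iff_ne_zero`), because no NONZERO class was provably
absolute Hodge: for `X` of positive dimension and `2p ≤ 2 dim X`, a conjugation chart for `(σ, X, 2p)` needs
a smooth affine probe `π : Y ⟶ X` with `(π^σ)^*` injective on `H²ᵖ(X^σ(ℂ); ℂ)` (Jouanolou, named fact
`jouanolou_cohomologyChart`), and the clause "every conjugate is a twisted rational `(p,p)`-class" needs
single-valuedness of chart conjugation (named fact `chartConjugation_canonical`).

In DEGREE ZERO neither device is needed, on ANY smooth projective `X/ℂ` (toolkit: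
`BoundaryReadoutBoundarySupplyDegreeZeroCharts`): `X^σ(ℂ)` is path connected, so a complex point is an affine
probe injective on `H⁰(X^σ) = ℂ · 1`; and a natural, rationally normalised de Rham family has `e[1] = λ · 1`
with ONE rational `λ ≠ 0` on all manifolds of the chart, while conjugation of functions is `σ` on values —
so in every chart every conjugate of `r · 1_X` (`r ∈ ℚ`) is `r · 1_{X^σ}`.

* `exists_isConjugateClass_degree_zero`, `isConjugateClass_degree_zero_unique` — existence (in the chart
  probed by a complex point) and uniqueness (in every chart) of the `σ`-conjugate of `r · 1_X`;
* `isAbsoluteHodgeClass_degree_zero` — **every rational class `r · 1 ∈ H⁰(X(ℂ); ℂ)` on a smooth projective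
  `X` is absolute Hodge**: the first absolute Hodge classes of the tree that are NONZERO and live on
  positive-dimensional varieties (Charles–Schnell Def. 11.2.3; Deligne's `ℚ(0)`);
* `cycleClassesAbsolute_degree_zero`, `hodgeIsAbsolute_degree_zero` — the `p = 0` cases of the registered
  stub `CycleClassesAbsolute` (lines `birth` / `qbar-fibre`) and of Conj. 11.2.17;
* `boundarySupply_degree_zero` — the `p = 0` case of the crux (constant family, `absoluteSupply`);
* `boundarySupply_iff_pos_ne_zero` — hence **the crux is equivalent to its restriction to NONZERO classes in
  the Hodge range `1 ≤ p ≤ dim X`**: its content is now pinned EXACTLY (sharpens `boundarySupply_iff_ne_zero`).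

References: [CharlesSchnell2014Notes] §11.2.2 (11.2.1)–(11.2.3), Def. 11.2.3, Conj. 11.2.17;
[Deligne1982HodgeCycles] §2; [HatcherAT2002] §3.1 p. 199; [BottTu1982Forms] §I.5; [Hartshorne1977] III.10.1.
-/

-- every declaration of this problem lives in `Summit.HodgeConjecture.HodgeConjecture.…` (summit = sub-problem)
set_option linter.dupNamespace false

noncomputable section

namespace Summit.HodgeConjecture.HodgeConjecture.Theorems

open CategoryTheory CategoryTheory.Limits AlgebraicGeometry MonoidalCategory
open scoped Manifold ContDiff
open Literature.AlgebraicTopology.SingularHomology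
open Literature.AlgebraicGeometry.Motives Literature.AlgebraicGeometry.HodgeTheory
open Literature.NumberTheory.Transcendental Literature.Geometry.Kaehler
open Summit.HodgeConjecture.HodgeConjecture.Theses
open Summit.HodgeConjecture.HodgeConjecture.Theorems.BallQuotientHodgeAbsolute.Negative

/-! ### Degree-zero conjugates on a smooth projective variety: existence and uniqueness -/

section DegreeZero

variable {n : ℕ} {X : SchemeOver ℂ}

/-- **Existence of degree-zero conjugates.** For `X` smooth projective, `σ ∈ Aut ℂ` and `r ∈ ℚ`, the
class `r · 1_X ∈ H⁰(X(ℂ); ℂ)` has a `σ`-conjugate in the chart probed by a complex point `Spec ℂ ⟶ X`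
(injective on `H⁰(X^σ)`, `X^σ(ℂ)` path connected): the constant expression `κ · 1`, `κ = r / λ_e`,
represents `r · 1` through the chart's de Rham family `e` (`e[κ · 1] = κ λ_e · 1`), and its conjugate
`σ(κ) · 1` represents `(σ(κ) λ_e) · 1_{X^σ}`. [cite: CharlesSchnell2014Notes, §11.2.2 (11.2.1)–(11.2.3)] -/
theorem exists_isConjugateClass_degree_zero (hX : IsSmoothProjective n X) (σ : ℂ ≃+* ℂ) (r : ℚ) :
    ∃ c', IsConjugateClass σ X 0 ((r : ℂ) • singularCohomology.one ℂ (ComplexPoints X)) c' := by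
  have hXσ : IsSmoothProjective n (conjugateVariety σ X) := IsSmoothProjective.conjugateVariety_holds σ hX
  haveI := pathConnectedSpace_complexPoints_of_isSmoothProjective hX
  haveI := pathConnectedSpace_complexPoints_of_isSmoothProjective hXσ
  obtain ⟨x₀⟩ : Nonempty (ComplexPoints X) := inferInstance
  -- the probe: a complex point, affine and smooth of relative dimension `0`
  haveI : IsAffine (specOver ℂ ℂ).left := inferInstanceAs (IsAffine (Spec _))
  haveI := smoothOfRelativeDimension_specOver_hom
  haveI : Nonempty (ComplexPoints (specOver ℂ ℂ)) := ⟨𝟙 _⟩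
  haveI : Nonempty (ComplexPoints (conjugateVariety σ (specOver ℂ ℂ))) :=
    nonempty_complexPoints_conjugateVariety σ
  have hinj : Function.Injective (complexBetti.map (conjHom σ (x₀ : specOver ℂ ℂ ⟶ X)) 0) :=
    complexBetti_map_zero_injective _
  obtain ⟨A⟩ := nonempty_analyticModel_of_isAffine 0 (specOver ℂ ℂ)
  obtain ⟨A'⟩ := nonempty_analyticModel_of_isAffine 0 (conjugateVariety σ (specOver ℂ ℂ))
  obtain ⟨e, he, hr⟩ := exists_isRational_complexDeRhamIsoFamily_holds (Fin 0 → ℂ)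
  obtain ⟨l, hl0, hl⟩ := exists_unitScalar e he
  let D : ConjugationChart σ X 0 :=
    { m := 0, Y := specOver ℂ ℂ, π := (x₀ : specOver ℂ ℂ ⟶ X), E := Fin 0 → ℂ, an := A, anConj := A'
      deRham := e, deRham_isNatural := he, deRham_isRational := hr 0, injective_map := hinj }
  set κ : ℂ := (r : ℂ) / l with hκ
  -- the constant expression `κ · 1` on the point, and its two (closed) realisations
  let ξ : AlgFormExpr (specOver ℂ ℂ) 0 :=
    ⟨1, fun _ ↦ (specOver ℂ ℂ).hom.appTop ((Scheme.ΓSpecIso (.of ℂ)).inv κ), fun _ ↦ Fin.elim0⟩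
  have hξ : ξ.realize A ∈ cclosedSmoothForms (Fin 0 → ℂ) A.carrier 0 := by
    rw [realize_constExpr]
    exact Submodule.smul_mem _ κ (cclosedOne (Fin 0 → ℂ) A.carrier).2
  have hξ' : (ξ.conj σ).realize A' ∈ cclosedSmoothForms (Fin 0 → ℂ) A'.carrier 0 := by
    rw [realize_conj_constExpr]
    exact Submodule.smul_mem _ (σ κ) (cclosedOne (Fin 0 → ℂ) A'.carrier).2
  have h1 : (⟨ξ.realize A, hξ⟩ : cclosedSmoothForms (Fin 0 → ℂ) A.carrier 0) =
      κ • cclosedOne (Fin 0 → ℂ) A.carrier :=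
    Subtype.ext (realize_constExpr A κ)
  have h1' : (⟨(ξ.conj σ).realize A', hξ'⟩ : cclosedSmoothForms (Fin 0 → ℂ) A'.carrier 0) =
      σ κ • cclosedOne (Fin 0 → ℂ) A'.carrier :=
    Subtype.ext (realize_conj_constExpr σ A' κ)
  refine ⟨(σ κ * l) • singularCohomology.one ℂ _, D, ξ, hξ, hξ', ?_, ?_⟩
  · change A.pullback 0 (complexBetti.map (x₀ : specOver ℂ ℂ ⟶ X) 0 ((r : ℂ) • singularCohomology.one ℂ _)) =
      e A.carrier 0 (complexDeRhamCohomology.mk (Fin 0 → ℂ) A.carrier 0 ⟨_, hξ⟩)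
    rw [h1, apply_mk_smul_cclosedOne e (hl A.carrier), map_smul, complexBetti_map_one, map_smul,
      singularCohomology.map_one, hκ, div_mul_cancel₀ _ hl0]
  · change A'.pullback 0 (complexBetti.map (conjHom σ (x₀ : specOver ℂ ℂ ⟶ X)) 0
        ((σ κ * l) • singularCohomology.one ℂ _)) =
      e A'.carrier 0 (complexDeRhamCohomology.mk (Fin 0 → ℂ) A'.carrier 0 ⟨_, hξ'⟩)
    rw [h1', apply_mk_smul_cclosedOne e (hl A'.carrier), map_smul, complexBetti_map_one, map_smul,
      singularCohomology.map_one]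

/-- **Uniqueness of degree-zero conjugates: every chart conjugate of `r · 1_X` is `r · 1_{X^σ}`**
(`r ∈ ℚ`, `X` smooth projective). In ANY chart `D` (smooth affine `Y`, any analytic models, any natural
rationally normalised family `e`): the representing expression `ξ = ∑ fⱼ` has `e[ξ] = r · 1`, so (no exact
`0`-forms) `∑ fⱼ ≡ r/λ_e ∈ ℚ` at every complex point of `Y`; its conjugate `∑ fⱼ^σ` then takes the value
`σ(r/λ_e) = r/λ_e` at every point of `Y^σ` (`exists_untwist`, `λ_e ∈ ℚ` by `exists_rat_unitScalar`), so
`e[ξ^σ] = r · 1_{(Y^σ)^an}`; and `(π^σ)^* c' = r · (π^σ)^* 1` with `(π^σ)^*` injective on `H⁰`.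
No Grothendieck comparison is needed in degree `0`. [cite: CharlesSchnell2014Notes, §11.2.2 (11.2.2)–(11.2.3)] -/
theorem isConjugateClass_degree_zero_unique (hX : IsSmoothProjective n X) (σ : ℂ ≃+* ℂ) (r : ℚ)
    {c' : complexBetti (conjugateVariety σ X) 0}
    (h : IsConjugateClass σ X 0 ((r : ℂ) • singularCohomology.one ℂ (ComplexPoints X)) c') :
    c' = (r : ℂ) • singularCohomology.one ℂ (ComplexPoints (conjugateVariety σ X)) := by
  have hXσ : IsSmoothProjective n (conjugateVariety σ X) := IsSmoothProjective.conjugateVariety_holds σ hX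
  haveI := pathConnectedSpace_complexPoints_of_isSmoothProjective hX
  haveI := pathConnectedSpace_complexPoints_of_isSmoothProjective hXσ
  obtain ⟨D, ξ, hξ, hξ', h1, h2⟩ := h
  -- the chart's de Rham family has ONE rational degree-zero scalar `q ≠ 0` on all its manifolds
  obtain ⟨q, hq0, hq⟩ := exists_rat_unitScalar D.deRham D.deRham_isNatural D.deRham_isRational
  -- `Y^σ(ℂ)`, hence the conjugate model, is nonempty (injectivity of `(π^σ)^*` on `H⁰`)
  haveI : Nonempty (ComplexPoints (conjugateVariety σ D.Y)) :=
    nonempty_complexPoints_of_injective (conjHom σ D.π) D.injective_map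
  haveI : Nonempty D.anConj.carrier := ⟨D.anConj.homeomorph.symm (Classical.arbitrary _)⟩
  -- (1) the representing expression realises to the constant `r / q`
  have hreal : complexDeRhamCohomology.mk D.E D.an.carrier 0 ⟨ξ.realize D.an, hξ⟩ =
      ((r : ℂ) / q) • complexDeRhamCohomology.one D.E D.an.carrier := by
    apply (D.deRham D.an.carrier 0).injective
    rw [← h1, map_smul, complexBetti_map_one, map_smul, singularCohomology.map_one,
      complexDeRhamCohomology.one, ← map_smul, apply_mk_smul_cclosedOne D.deRham (hq D.an.carrier),
      div_mul_cancel₀ _ hq0]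
  have hval : ∀ P : ComplexPoints D.Y, ∑ j : Fin ξ.size, P.eval ⊤ trivial (ξ.coef j) = (r : ℂ) / q := by
    intro P
    have hx := apply_eq_of_mk_eq_smul_one hξ hreal (D.an.homeomorph.symm P) Fin.elim0
    rw [realize_apply_of_degree_zero] at hx
    simp only [regularFun_eq_eval] at hx
    have hP : D.an.toComplexPoints (D.an.homeomorph.symm P) = P := D.an.homeomorph.apply_symm_apply P
    simpa only [hP] using hx
  -- (2) the conjugate expression realises to the constant `σ (r / q) = r / q`
  have hval' : ∀ x : D.anConj.carrier, (ξ.conj σ).realize D.anConj x Fin.elim0 = (r : ℂ) / q := by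
    intro x
    rw [realize_apply_of_degree_zero]
    change ∑ j : Fin ξ.size, D.anConj.regularFun ((baseChangeHomFst σ.toRingHom D.Y).appTop (ξ.coef j)) x = _
    simp only [regularFun_eq_eval]
    obtain ⟨P, hP⟩ := exists_untwist σ (D.anConj.toComplexPoints x)
    change ∑ j : Fin ξ.size, (D.anConj.toComplexPoints x).eval ⊤ trivial
        ((baseChangeHomFst σ.toRingHom D.Y).appTop (ξ.coef j)) = _
    have hsum : ∑ j : Fin ξ.size, (D.anConj.toComplexPoints x).eval ⊤ trivial
        ((baseChangeHomFst σ.toRingHom D.Y).appTop (ξ.coef j)) = σ (∑ j : Fin ξ.size, P.eval ⊤ trivial (ξ.coef j)) := by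
      rw [map_sum]
      exact Finset.sum_congr rfl fun j _ ↦ hP _
    rw [hsum, hval P, ← Rat.cast_div, map_ratCast]
  have hreal' : complexDeRhamCohomology.mk D.E D.anConj.carrier 0 ⟨(ξ.conj σ).realize D.anConj, hξ'⟩ =
      ((r : ℂ) / q) • complexDeRhamCohomology.one D.E D.anConj.carrier := by
    rw [complexDeRhamCohomology.one, ← map_smul]
    congr 1
    apply Subtype.ext
    rw [Submodule.coe_smul, coe_cclosedOne]
    funext x
    ext v
    rw [Subsingleton.elim v Fin.elim0, hval' x]
    simp [MForm.ofFun_apply]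
  -- (3) read `c'` off the second chart identity
  have hc' := singularCohomology_zero_eq_smul_one c'
  rw [hc'] at h2 ⊢
  rw [map_smul, complexBetti_map_one, map_smul, singularCohomology.map_one, hreal',
    complexDeRhamCohomology.one, ← map_smul, apply_mk_smul_cclosedOne D.deRham (hq D.anConj.carrier),
    div_mul_cancel₀ _ hq0] at h2
  rw [smul_one_injective h2]

/-- **Every rational degree-zero class on a smooth projective complex variety is absolute Hodge.**
For `X/ℂ` smooth projective of dimension `n` and `c ∈ H⁰(X(ℂ); ℂ)` rational (so `c = r · 1`, `r ∈ ℚ`,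
`X(ℂ)` being connected): `c` is of type `(0,0)`, for every `σ ∈ Aut ℂ` a conjugate exists in the chart
probed by a complex point (`exists_isConjugateClass_degree_zero`), and EVERY conjugate, in every chart,
is `r · 1_{X^σ} = (2πi/σ(2πi))⁰ · (r · 1_{X^σ})`, a rational `(0,0)`-class
(`isConjugateClass_degree_zero_unique`). These are the first NONZERO absolute Hodge classes of the
tree, on varieties of every dimension — Deligne's `ℚ(0)`; neither Jouanolou's device nor Grothendieck's
comparison theorem is used. [cite: CharlesSchnell2014Notes, Def. 11.2.3] [cite: Deligne1982HodgeCycles, §2] -/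
theorem isAbsoluteHodgeClass_degree_zero (hX : IsSmoothProjective n X) (c : complexBetti X (2 * 0))
    (hc : IsRationalClass c) : IsAbsoluteHodgeClass n X 0 c := by
  haveI := pathConnectedSpace_complexPoints_of_isSmoothProjective hX
  obtain ⟨r, hr⟩ : ∃ r : ℚ, c = (r : ℂ) • singularCohomology.one ℂ (ComplexPoints X) :=
    exists_rat_eq_smul_one_of_isRationalClass hc
  obtain ⟨A⟩ := nonempty_hodgeModel_holds hX
  refine ⟨hc, isOfHodgeType_zero_zero_zero A c, fun σ ↦ ⟨?_, fun c' hc' ↦ ?_⟩⟩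
  · rw [hr]
    exact exists_isConjugateClass_degree_zero hX σ r
  · have hXσ : IsSmoothProjective n (conjugateVariety σ X) := IsSmoothProjective.conjugateVariety_holds σ hX
    obtain ⟨Aσ⟩ := nonempty_hodgeModel_holds hXσ
    rw [hr] at hc'
    have h := isConjugateClass_degree_zero_unique hX σ r hc'
    refine ⟨c', ?_, isOfHodgeType_zero_zero_zero Aσ c', ?_⟩
    · rw [h]
      exact (isRationalClass_one _).smul r
    · rw [periodTwist, pow_zero, one_smul]

/-- The same, in the hypothesis shape of the crux and of Conj. 11.2.17 (the Hodge-type hypothesis is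
automatic in degree `0`). [cite: CharlesSchnell2014Notes, Def. 11.2.3 and Conj. 11.2.17] -/
theorem isAbsoluteHodgeClass_of_degree_zero (hX : IsSmoothProjective n X) (c : complexBetti X (2 * 0))
    (hc : IsRationalClass c) (_hpp : IsOfHodgeType n X (2 * 0) 0 0 c) : IsAbsoluteHodgeClass n X 0 c :=
  isAbsoluteHodgeClass_degree_zero hX c hc

end DegreeZero

/-! ### Consequences for the crux `BoundarySupply` and the stub `CycleClassesAbsolute` -/

section Crux

variable {n : ℕ} {X : SchemeOver ℂ}

/-- **The `p = 0` case of the registered stub `CycleClassesAbsolute`** (lines `birth` / `qbar-fibre` of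
the crux `BoundarySupply`; in degree `0` every class is algebraic, `algebraicClasses_zero = ⊤`, so the
stub's content there is exactly `isAbsoluteHodgeClass_degree_zero`). [cite: CharlesSchnell2014Notes, §11.2.2] -/
theorem cycleClassesAbsolute_degree_zero (hX : IsSmoothProjective n X) (c : complexBetti X (2 * 0))
    (hc : IsRationalClass c) (_hpp : IsOfHodgeType n X (2 * 0) 0 0 c) (_halg : c ∈ algebraicClasses X 0) :
    IsAbsoluteHodgeClass n X 0 c :=
  isAbsoluteHodgeClass_degree_zero hX c hc

/-- **The `p = 0` case of the crux `BoundarySupply`**: every rational degree-zero class on a smooth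
projective `X` is supplied — it is absolute Hodge, so the constant family `X × ℙ¹ ⟶ ℙ¹` with the one
piece `Y = X` is a witness (`absoluteSupply`). [cite: CharlesSchnell2014Notes, Def. 11.2.3]
[cite: Hartshorne1977, II Ex. 5.11 and III Prop. 10.1] -/
theorem boundarySupply_degree_zero (hX : IsSmoothProjective n X) (c : complexBetti X (2 * 0))
    (hc : IsRationalClass c) (hpp : IsOfHodgeType n X (2 * 0) 0 0 c) :
    ∃ (N : ℕ) (𝒳 C : SchemeOver ℂ) (f : 𝒳 ⟶ C) (o t : AlgPoints C ℂ) (ι : Type) (_ : Finite ι)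
      (m : ι → ℕ) (Y : ι → SchemeOver ℂ) (g : ∀ i, Y i ⟶ fiberOver f o)
      (ξ : complexBetti 𝒳 (2 * 0)) (n' : ℕ) (e : X ⟶ fiberOver f t),
      IsSmoothProjective N 𝒳 ∧ IsSmoothProjective 1 C ∧ Function.Surjective f.left.base ∧
      (∀ i, IsSmoothProjective (m i) (Y i)) ∧
      (∀ x : ↥(fiberOver f o).left, ∃ (i : ι) (y : ↥(Y i).left), (g i).left.base y = x) ∧
      IsRationalClass ξ ∧ IsOfHodgeType N 𝒳 (2 * 0) 0 0 ξ ∧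
      (∀ i, IsAbsoluteHodgeClass (m i) (Y i) 0 (complexBetti.map (g i ≫ fiberι f o) (2 * 0) ξ)) ∧
      IsSmoothProjective n' (fiberOver f t) ∧
      complexBetti.map e (2 * 0) (complexBetti.map (fiberι f t) (2 * 0) ξ) = c :=
  absoluteSupply hX 0 c (isAbsoluteHodgeClass_of_degree_zero hX c hc hpp)

/-- **The content of the crux, exactly.** `BoundarySupply` is EQUIVALENT to its restriction to NONZERO
classes in the Hodge range `1 ≤ p ≤ dim X`: degree `0` is supplied by `boundarySupply_degree_zero`,
`c = 0` by the zero floor, and `p > dim X` is empty (`boundarySupply_iff_ne_zero`). What remains is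
precisely the supply of nonzero Hodge classes of positive degree — Charles–Schnell Conj. 11.2.17 inside
the route (`boundarySupply_iff_hodgeClassesAbsolute`, `boundarySupply_iff_absolutePullbacks`).
[cite: CharlesSchnell2014Notes, §11.2.5 Conj. 11.2.17] -/
theorem boundarySupply_iff_pos_ne_zero :
    BoundaryReadout.BoundarySupply ↔
      ∀ ⦃n : ℕ⦄ ⦃X : SchemeOver ℂ⦄, IsSmoothProjective n X →
        ∀ (p : ℕ) (c : complexBetti X (2 * p)), IsRationalClass c → IsOfHodgeType n X (2 * p) p p c →
          1 ≤ p → p ≤ n → c ≠ 0 →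
          ∃ (N : ℕ) (𝒳 C : SchemeOver ℂ) (f : 𝒳 ⟶ C) (o t : AlgPoints C ℂ) (ι : Type) (_ : Finite ι)
            (m : ι → ℕ) (Y : ι → SchemeOver ℂ) (g : ∀ i, Y i ⟶ fiberOver f o)
            (ξ : complexBetti 𝒳 (2 * p)) (n' : ℕ) (e : X ⟶ fiberOver f t),
            IsSmoothProjective N 𝒳 ∧ IsSmoothProjective 1 C ∧ Function.Surjective f.left.base ∧
            (∀ i, IsSmoothProjective (m i) (Y i)) ∧
            (∀ x : ↥(fiberOver f o).left, ∃ (i : ι) (y : ↥(Y i).left), (g i).left.base y = x) ∧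
            IsRationalClass ξ ∧ IsOfHodgeType N 𝒳 (2 * p) p p ξ ∧
            (∀ i, IsAbsoluteHodgeClass (m i) (Y i) p
              (complexBetti.map (g i ≫ fiberι f o) (2 * p) ξ)) ∧
            IsSmoothProjective n' (fiberOver f t) ∧
            complexBetti.map e (2 * p) (complexBetti.map (fiberι f t) (2 * p) ξ) = c := by
  rw [boundarySupply_iff_ne_zero]
  refine ⟨fun h n X hX p c hc hpp hp hpn hc0 ↦ h hX p c hc hpp (Or.inr ⟨hpn, hc0⟩),
    fun h n X hX p c hc hpp hcase ↦ ?_⟩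
  rcases hcase with hp | ⟨hpn, hc0⟩
  · subst hp
    exact boundarySupply_degree_zero hX c hc hpp
  · rcases Nat.eq_zero_or_pos p with hp | hp
    · subst hp
      exact boundarySupply_degree_zero hX c hc hpp
    · exact h hX p c hc hpp hp hpn hc0

/-- **Conj. 11.2.17 in degree zero** (the `p = 0` case of `HodgeIsAbsolute`, the content of the crux by
`boundarySupply_iff_hodgeClassesAbsolute`): on a smooth projective `X` every rational `(0,0)`-class is
absolute Hodge. [cite: CharlesSchnell2014Notes, Conj. 11.2.17] -/
theorem hodgeIsAbsolute_degree_zero :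
    ∀ ⦃n : ℕ⦄ ⦃X : SchemeOver ℂ⦄, IsSmoothProjective n X →
      ∀ c : complexBetti X (2 * 0), IsRationalClass c → IsOfHodgeType n X (2 * 0) 0 0 c →
        IsAbsoluteHodgeClass n X 0 c :=
  fun _ _ hX c hc hpp ↦ isAbsoluteHodgeClass_of_degree_zero hX c hc hpp

end Crux

end Summit.HodgeConjecture.HodgeConjecture.Theorems

end
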